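import Mathlib

/-!
# Crux `GappedShellCensus.FiveFoldRationingR` (stmt-AtomisticToContinuum-18071), line `Sketch` —
# stub `stub_ffrLineCensus` (counting on a quasi-line)

If the five-sites of a configuration are empty or form ONE bi-infinite chain `z : ℤ → ℝ³` that is
`a/2`-quasi-geodesic (`|i - j| · a/2 ≤ dist (z i) (z j)`), then they satisfy the zero-density census: about
`p = z 0`, the five-sites in `B̄(p, r)` are `z i` with `|i| ≤ 2r/a`, so there are `≤ 4r/a + 1 ≤ 5r/a` of them
for `r ≥ a`, which is `≤ ε (r/a)³` once `r/a ≥ 5/ε + 1`.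
-/

noncomputable section

namespace Summit.AtomisticToContinuum.Crystallization.Theorems

/-- Index bound on a quasi-line: if `|i - 0| · a/2 ≤ r` (`a > 0`) then `i ∈ [-⌊2r/a⌋₊, ⌊2r/a⌋₊]`. -/
theorem ffrLine_index_mem_Icc {a r : ℝ} (ha : 0 < a) {i : ℤ}
    (h : |((i : ℝ) - ((0 : ℤ) : ℝ))| * a / 2 ≤ r) :
    i ∈ Finset.Icc (-(⌊2 * r / a⌋₊ : ℤ)) (⌊2 * r / a⌋₊ : ℤ) := by
  rw [Int.cast_zero, sub_zero] at h
  have habs : |(i : ℝ)| ≤ 2 * r / a := by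
    rw [le_div_iff₀ ha]
    linarith
  have hnat : ((i.natAbs : ℕ) : ℝ) ≤ 2 * r / a := by
    rw [Nat.cast_natAbs, Int.cast_abs]
    exact habs
  have hfl : i.natAbs ≤ ⌊2 * r / a⌋₊ := Nat.le_floor hnat
  rw [Finset.mem_Icc]
  omega

/-- Cardinality of the integer interval `[-N, N]` is `2N + 1`. -/
theorem ffrLine_card_Icc (N : ℕ) : (Finset.Icc (-(N : ℤ)) (N : ℤ)).card = 2 * N + 1 := by
  rw [Int.card_Icc]
  omega

/-- Arithmetic: for `0 < a`, `0 < ε` and `a * (5/ε + 1) ≤ r` we have `2 · (2r/a) + 1 ≤ ε (r/a)³`. -/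
theorem ffrLine_arith {a ε r : ℝ} (ha : 0 < a) (hε : 0 < ε) (hr : a * (5 / ε + 1) ≤ r) :
    2 * (2 * r / a) + 1 ≤ ε * (r / a) ^ 3 := by
  set t := r / a with ht
  have ht1 : 5 / ε + 1 ≤ t := by
    rw [ht, le_div_iff₀ ha]
    linarith
  have h5 : 0 < 5 / ε := by positivity
  have ht0 : 1 ≤ t := by linarith
  have hεt : 5 ≤ ε * t := by
    have : ε * (5 / ε) = 5 := by field_simp
    nlinarith
  have h2 : 2 * (2 * r / a) + 1 = 4 * t + 1 := by rw [ht]; ring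
  rw [h2]
  have : 4 * t + 1 ≤ 5 * t := by linarith
  have htpos : 0 < t := by linarith
  calc 4 * t + 1 ≤ 5 * t := this
    _ ≤ (ε * t) * t := by nlinarith
    _ ≤ (ε * t) * t * t := le_mul_of_one_le_right (by positivity) ht0
    _ = ε * t ^ 3 := by ring

/-- **Stub Q (counting on a quasi-line).** If the five-sites are empty or form an `a/2`-quasi-geodesic chain
`z : ℤ → ℝ³`, they satisfy the zero-density census: the chain meets `B̄(z 0, r)` in sites `z i` with
`|i| ≤ 2r/a`, so there are `≤ 4r/a + 1 ≤ ε (r/a)³` of them once `r ≥ a (5/ε + 1)`. [folklore] -/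
theorem stub_ffrLineCensus :
    ∀ (Y : Set (EuclideanSpace ℝ (Fin 3))) (a : ℝ), 0 < a →
      ({y ∈ Y | ∃ v ∈ Y, v ≠ y ∧ dist y v ≤ a * (1 + 1 / 50) ∧
          5 ≤ {w ∈ Y | w ≠ y ∧ w ≠ v ∧ dist y w ≤ a * (1 + 1 / 50) ∧
            dist v w ≤ a * (1 + 1 / 50)}.ncard} = ∅ ∨
        ∃ z : ℤ → EuclideanSpace ℝ (Fin 3), (∀ i, z i ∈ Y) ∧
          (∀ i, dist (z i) (z (i + 1)) ≤ a * (1 + 1 / 50)) ∧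
          (∀ i j : ℤ, |((i : ℝ) - j)| * a / 2 ≤ dist (z i) (z j)) ∧
          {y ∈ Y | ∃ v ∈ Y, v ≠ y ∧ dist y v ≤ a * (1 + 1 / 50) ∧
              5 ≤ {w ∈ Y | w ≠ y ∧ w ≠ v ∧ dist y w ≤ a * (1 + 1 / 50) ∧
                dist v w ≤ a * (1 + 1 / 50)}.ncard} = Set.range z) →
      ∀ ε : ℝ, 0 < ε → ∀ r₀ : ℝ, ∃ (p : EuclideanSpace ℝ (Fin 3)) (r : ℝ), r₀ ≤ r ∧
        (({y ∈ Y | ∃ v ∈ Y, v ≠ y ∧ dist y v ≤ a * (1 + 1 / 50) ∧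
            5 ≤ {w ∈ Y | w ≠ y ∧ w ≠ v ∧ dist y w ≤ a * (1 + 1 / 50) ∧
              dist v w ≤ a * (1 + 1 / 50)}.ncard} ∩ Metric.closedBall p r).ncard : ℝ) ≤ ε * (r / a) ^ 3 := by
  intro Y a ha hF ε hε r₀
  rcases hF with hempty | ⟨z, -, -, hq, hFz⟩
  · -- no five-sites: any centre, radius `max r₀ 0`
    refine ⟨0, max r₀ 0, le_max_left _ _, ?_⟩
    rw [hempty, Set.empty_inter, Set.ncard_empty, Nat.cast_zero]
    have : 0 ≤ max r₀ 0 / a := div_nonneg (le_max_right _ _) ha.le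
    positivity
  · -- one quasi-line: centre `z 0`, radius `max r₀ (a (5/ε + 1))`
    set r := max r₀ (a * (5 / ε + 1)) with hr
    have hr1 : a * (5 / ε + 1) ≤ r := le_max_right _ _
    refine ⟨z 0, r, le_max_left _ _, ?_⟩
    rw [hFz]
    set N : ℕ := ⌊2 * r / a⌋₊ with hN
    -- the five-sites in the ball are `z i` with `i ∈ [-N, N]`
    have hsub : Set.range z ∩ Metric.closedBall (z 0) r ⊆
        z '' (↑(Finset.Icc (-(N : ℤ)) (N : ℤ)) : Set ℤ) := by
      rintro x ⟨⟨i, rfl⟩, hx⟩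
      rw [Metric.mem_closedBall] at hx
      refine ⟨i, ?_, rfl⟩
      rw [Finset.mem_coe]
      exact ffrLine_index_mem_Icc ha ((hq i 0).trans hx)
    have hfin : (z '' (↑(Finset.Icc (-(N : ℤ)) (N : ℤ)) : Set ℤ)).Finite :=
      (Finset.finite_toSet _).image z
    have hle : (Set.range z ∩ Metric.closedBall (z 0) r).ncard ≤ 2 * N + 1 :=
      calc (Set.range z ∩ Metric.closedBall (z 0) r).ncard
          ≤ (z '' (↑(Finset.Icc (-(N : ℤ)) (N : ℤ)) : Set ℤ)).ncard := Set.ncard_le_ncard hsub hfin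
        _ ≤ ((↑(Finset.Icc (-(N : ℤ)) (N : ℤ)) : Set ℤ)).ncard := Set.ncard_image_le (Finset.finite_toSet _)
        _ = 2 * N + 1 := by rw [Set.ncard_coe_finset, ffrLine_card_Icc]
    have hcast : ((Set.range z ∩ Metric.closedBall (z 0) r).ncard : ℝ) ≤ 2 * (N : ℝ) + 1 := by
      exact_mod_cast hle
    have hNle : (N : ℝ) ≤ 2 * r / a := by
      rw [hN]
      refine Nat.floor_le ?_
      have : 0 ≤ r := le_trans (by positivity) hr1
      positivity
    calc ((Set.range z ∩ Metric.closedBall (z 0) r).ncard : ℝ) ≤ 2 * (N : ℝ) + 1 := hcast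
      _ ≤ 2 * (2 * r / a) + 1 := by linarith
      _ ≤ ε * (r / a) ^ 3 := ffrLine_arith ha hε hr1

end Summit.AtomisticToContinuum.Crystallization.Theorems

end
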